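import Literature.GroupTheory.CombinatorialGroupTheory.FibredTranslationCocycles
import Literature.GroupTheory.CombinatorialGroupTheory.PuncturedSurfaceGroupCusps
import Mathlib.GroupTheory.QuotientGroup.Basic
import Mathlib.Algebra.Group.Subgroup.Pointwise
import Mathlib.GroupTheory.GroupAction.ConjAct
import Mathlib.GroupTheory.Index
import Mathlib.Tactic.Ring
import HarnessLib

/-!
# The node twist: level homomorphisms of `Γ_{g,r}` that see ONE level node, for the node loop `∏_{i<g₀}[a_i,b_i] ∈ [Γ,Γ]`

Topic `Literature/GroupTheory/CombinatorialGroupTheory`; PROOF-ONLY (0 definitions).  Mochizuki, [CombGC], PROOF of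
Prop. 1.2, p. 9, the resp'd (EDGE) case [cite: MochizukiCombGC2007, Prop 1.2 proof p.9]: "there exists a finite
étale … `Π_G`-covering `G′ → G` whose restriction to the anabelioid `G_{e₂}` is trivial …, but whose restriction to
the anabelioid `G_{e₁}` is nontrivial.  But, in light of our assumption that `G` is sturdy, one verifies immediately
that by gluing together appropriate finite étale coverings of the anabelioids `G_v`, `G_e`, one may construct a
finite étale covering `G′ → G` with the desired properties."  The DISCRETE half of this gluing at the NODE of the
two-component degeneration `Γ_{g,r} = A *_{⟨x⟩} B`, node loop `x = ∏_{i<g₀}[a_i,b_i]` (`1 ≤ g₀ ≤ g − 1`): `x` is a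
product of commutators, so every character of `Γ` and every abelian twist (the vertex twist of
`PuncturedSurfaceGroupVertexTwist.lean`, the cut-off characters of `FreeBasisCutoffCharacterTwist.lean`) kills
all conjugates of `⟨x⟩` — the node needs a NON-ABELIAN finite quotient glued from Heisenberg covers of the two
level vertices adjacent to the chosen level node.

THE TWIST (`exists_levelHom_nodeTwist`).  `N ⊴ Γ` of finite index, `Q = Γ/N`, `M` a group with a Heisenberg
triple `X Y X⁻¹ Y⁻¹ = Z` (`Z` central, `Z^m = 1 ↔ q ∣ m`, `q > [Γ:N]³`).  `Γ` acts on `Q × M`: the handle `0`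
(in `A`) and the handle `g − 1` (in `B`) act by fibred translations `(p, m) ↦ (s̄ p, κ_s(p) m)` built from the
ORBIT COCYCLES of `FibredTranslationCocycles.lean`, all other letters plainly; the commutator block of handle
`0` then multiplies the fibre by `W = [Y^{L_B}, X^{L_A}] = Z^{−L_A L_B}` (`L_A = ord b̄_0`, `L_B = ord b̄_{g−1}`)
at ONE point and by `1` elsewhere, that of handle `g − 1` by `W⁻¹` at the matching point — so the one surface
relator acts trivially (`PresentedGroup.toGroup`) while `x` acts with net charge `W` on the `⟨x̄⟩`-orbit of
`π(f₁)⁻¹` and trivially on every other `⟨x̄⟩`-orbit.  `ψ : N → M` is the action of `N` on the fibre over `1`: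
`ψ(f₁ x^{[Γ:N]} f₁⁻¹)` is a conjugate of `W^e`, `1 ≤ e ≤ [Γ:N]`, nontrivial as `q > [Γ:N]³`, and
`ψ(f₂ x^j f₂⁻¹) = 1` for every OTHER level node `f₂` (`f₁⁻¹ f₂ ∉ ⟨x⟩·N`).  No free basis, no Bass–Serre tree, no
peripheral structure of `A ∩ N` is used.  `exists_normal_separating_nodeTwist` packages `U = Ker ψ ⊴ N` in the
output shape of the discrete suppliers of abc-iut-w5-d047's `IsProSigmaCompletion.exists_open_unrSeparating_of_discrete`
(`Ha = Hk = ⟨x⟩`, `K = ⊥`); consumer: `PSCSeparatingCoveringsClosedSurfaceEdges.lean` (F-2827 at the cuspless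
carriers).  abc-iut-f-060 (gen 9), row «NODE-RESIDUAL@UNMARKED» of abc-iut-L3-lead γ85; nothing here bears on
[IUTchIII] Cor. 3.12.
-/

namespace Literature.GroupTheory.CombinatorialGroupTheory

/-! ### The node twist -/

namespace PuncturedSurfaceGroup

open NodeTwist
open scoped Pointwise

variable {g r : ℕ}

/-- **The node twist** ([CombGC] Prop. 1.2 proof p. 9, "gluing together appropriate finite étale coverings
of the anabelioids `G_v`, `G_e`", discrete form at the NODE of the two-component degeneration with node
loop `x = ∏_{i<g₀}[a_i,b_i] ∈ [Γ,Γ]`, `1 ≤ g₀ ≤ g − 1`).  `N ⊴ Γ_{g,r}` of finite index, `f₁ ∈ Γ_{g,r}`,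
and `M` a group with a Heisenberg triple `X Y X⁻¹ Y⁻¹ = Z`, `Z` central, `Z^m = 1 ↔ q ∣ m`,
`q > [Γ:N]³`.  Then some `ψ : N → M` SEES the level node of `f₁` — `ψ(f₁ x^{[Γ:N]} f₁⁻¹) ≠ 1` — and KILLS
every other level node over the node: `ψ(z) = 1` for `z ∈ f₂⟨x⟩f₂⁻¹ ∩ N` whenever `f₁⁻¹ f₂ ∉ ⟨x⟩·N`.
Construction: `Γ` acts on `(Γ/N) × M`, the handles `0` and `g−1` by fibred translations whose commutator
cocycles are `W·δ` and `W⁻¹·δ` at matched points (`W = Z^{−ord(b̄_0)·ord(b̄_{g−1})}`, orbit cocycles of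
`exists_orbitCocycle`), all other letters plainly; the one surface relator then acts trivially and `ψ` is
the action of `N` on the fibre over `1` — no free basis, no Bass–Serre tree, no peripheral structure.
[cite: MochizukiCombGC2007, Prop 1.2 proof p.9] -/
theorem exists_levelHom_nodeTwist {g₀ : ℕ} (hg₀ : 1 ≤ g₀) (hg : g₀ + 1 ≤ g)
    (x : PuncturedSurfaceGroup g r)
    (hx : x = ((List.finRange g).map fun i : Fin g => if (i : ℕ) < g₀ then
      a (r := r) i * b i * (a i)⁻¹ * (b i)⁻¹ else 1).prod)
    (N : Subgroup (PuncturedSurfaceGroup g r)) [hN : N.Normal] [N.FiniteIndex]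
    {M : Type*} [Group M] {X Y Z : M} (hXYZ : X * Y * X⁻¹ * Y⁻¹ = Z) (hZ : Z ∈ Subgroup.center M)
    {q : ℕ} (hZq : ∀ m : ℕ, Z ^ m = 1 ↔ q ∣ m) (hq : N.index ^ 3 < q)
    (f₁ : PuncturedSurfaceGroup g r) :
    ∃ ψ : N →* M,
      ψ ⟨f₁ * x ^ N.index * f₁⁻¹, hN.conj_mem _ (Subgroup.pow_index_mem N x) f₁⟩ ≠ 1 ∧
      ∀ f₂ : PuncturedSurfaceGroup g r,
        f₁⁻¹ * f₂ ∉ (Subgroup.zpowers x : Set (PuncturedSurfaceGroup g r)) *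
            (N : Set (PuncturedSurfaceGroup g r)) →
        ∀ (z : PuncturedSurfaceGroup g r) (hz : z ∈ (ConjAct.toConjAct f₂ • Subgroup.zpowers x) ⊓ N),
          ψ ⟨z, hz.2⟩ = 1 := by
  classical
  -- indices and words
  have hgpos : 0 < g := by omega
  have hg2 : 2 ≤ g := by omega
  set i₀ : Fin g := ⟨0, hgpos⟩ with hi₀
  set iL : Fin g := ⟨g - 1, by omega⟩ with hiL
  have hi₀L : i₀ ≠ iL := by
    simp only [hi₀, hiL, ne_eq, Fin.mk.injEq]; omega
  obtain ⟨w, hw⟩ : ∃ w : Fin g → PuncturedSurfaceGroup g r, ∀ i, w i = a i * b i * (a i)⁻¹ * (b i)⁻¹ :=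
    ⟨_, fun _ => rfl⟩
  have hwfun : (fun i : Fin g => a (r := r) i * b i * (a i)⁻¹ * (b i)⁻¹) = w := funext fun i => (hw i).symm
  have hxw : x = ((List.finRange g).map fun i : Fin g => if (i : ℕ) < g₀ then w i else 1).prod := by
    rw [hx, ← hwfun]
  have hwc : ((List.finRange g).map w).prod * ((List.finRange r).map fun j : Fin r => c (g := g) j).prod = 1 := by
    rw [← hwfun]; exact comm_prod_mul_cusp_prod_eq_one
  obtain ⟨x₁, hx₁⟩ : ∃ x₁ : PuncturedSurfaceGroup g r, x₁ = ((List.finRange g).map fun i : Fin g =>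
      if 1 ≤ (i : ℕ) then (if (i : ℕ) < g₀ then w i else 1) else 1).prod := ⟨_, rfl⟩
  obtain ⟨mid, hmid⟩ : ∃ mid : PuncturedSurfaceGroup g r, mid = ((List.finRange g).map fun i : Fin g =>
      if 1 ≤ (i : ℕ) then (if (i : ℕ) < g - 1 then w i else 1) else 1).prod := ⟨_, rfl⟩
  have hx_split : x = w i₀ * x₁ := by
    rw [hxw, hx₁]; exact prod_map_finRange_lt_eq_first_mul hgpos hg₀ w
  have hw_split : ((List.finRange g).map w).prod = w i₀ * mid * w iL := by
    rw [hmid]; exact prod_map_finRange_eq_first_mul_mid_mul_last hg2 w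
  -- the quotient
  set Q := PuncturedSurfaceGroup g r ⧸ N
  set π : PuncturedSurfaceGroup g r →* Q := QuotientGroup.mk' N with hπ
  have hπN : ∀ {y : PuncturedSurfaceGroup g r}, π y = 1 ↔ y ∈ N := fun {y} => by
    rw [hπ, QuotientGroup.mk'_apply, QuotientGroup.eq_one_iff]
  haveI : Finite Q := Subgroup.finite_quotient_of_finiteIndex
  have hcardQ : Nat.card Q = N.index := rfl
  set m := N.index with hm
  have hmpos : 0 < m := Nat.pos_of_ne_zero Subgroup.FiniteIndex.index_ne_zero
  -- the active letters and the orbit lengths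
  set uA := π (a i₀) with huA
  set vA := π (b i₀) with hvA
  set uB := π (a iL) with huB
  set vB := π (b iL) with hvB
  have hπw₀ : π (w i₀) = uA * vA * uA⁻¹ * vA⁻¹ := by rw [hw, map_mul, map_mul, map_mul, map_inv, map_inv]
  have hπwL : π (w iL) = uB * vB * uB⁻¹ * vB⁻¹ := by rw [hw, map_mul, map_mul, map_mul, map_inv, map_inv]
  set LA := orderOf vA with hLA
  set LB := orderOf vB with hLB
  have hLA_le : LA ≤ m := hcardQ ▸ orderOf_le_card
  have hLB_le : LB ≤ m := hcardQ ▸ orderOf_le_card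
  have hLA_pos : 0 < LA := (isOfFinOrder_of_finite vA).orderOf_pos
  have hLB_pos : 0 < LB := (isOfFinOrder_of_finite vB).orderOf_pos
  -- the Heisenberg elements of the two handles
  have hq1 : 1 ≤ q := by omega
  set YA := Y ^ LB with hYA
  set YB := Y ^ (LA * (q - 1)) with hYB
  -- the support points
  set p₁ : Q := π f₁⁻¹ with hp₁
  set cA : Q := π x₁ * p₁ with hcA
  set cB : Q := (π (mid * w iL))⁻¹ * cA with hcB
  -- the orbit cocycles
  obtain ⟨αA, hαA⟩ := exists_orbitCocycle vA (vA * uA⁻¹ * vA⁻¹ * cA) X YA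
  obtain ⟨αB, hαB⟩ := exists_orbitCocycle vB (vB * uB⁻¹ * vB⁻¹ * cB) X YB
  set W := YA * X ^ LA * YA⁻¹ * (X ^ LA)⁻¹ with hW
  have hW' : W = (Z ^ (LB * LA))⁻¹ := pow_comm_pow_eq_of_comm_eq_central hXYZ hZ LB LA
  have hZq1 : Z ^ q = 1 := (hZq q).mpr dvd_rfl
  have hexp : LA * (q - 1) * LB + LB * LA = q * (LA * LB) := by
    obtain ⟨q', hq'⟩ : ∃ q', q = q' + 1 := ⟨q - 1, by omega⟩
    subst hq'
    rw [Nat.add_sub_cancel]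
    ring
  have hWB : YB * X ^ LB * YB⁻¹ * (X ^ LB)⁻¹ = W⁻¹ := by
    rw [hYB, pow_comm_pow_eq_of_comm_eq_central hXYZ hZ (LA * (q - 1)) LB, hW', inv_inv]
    have h1 : Z ^ (LA * (q - 1) * LB) * Z ^ (LB * LA) = 1 := by
      rw [← pow_add, hexp, pow_mul, hZq1, one_pow]
    exact inv_eq_of_mul_eq_one_right h1
  -- the fibred translations
  obtain ⟨σaA, hσaA⟩ := exists_twistPerm (M := M) uA αA
  obtain ⟨σbA, hσbA⟩ := exists_twistPerm (M := M) vA (fun _ => X)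
  obtain ⟨σaB, hσaB⟩ := exists_twistPerm (M := M) uB αB
  obtain ⟨σbB, hσbB⟩ := exists_twistPerm (M := M) vB (fun _ => X)
  -- the plain translation
  obtain ⟨pl, hpl⟩ := exists_plainPerm (M := M) π
  have hpl' : ∀ y p m₀, pl y (p, m₀) = (π y * p, (1 : M) * m₀) := fun y p m₀ => by rw [hpl, one_mul]
  -- the commutator blocks of the two active handles
  have hBlA : ∀ p m₀, (σaA * σbA * σaA⁻¹ * σbA⁻¹) (p, m₀) =
      (uA * vA * uA⁻¹ * vA⁻¹ * p, (if p = cA then W else 1) * m₀) := by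
    intro p m₀
    rw [twist_comm_apply hσaA hσbA, hαA]
    have e1 : vA⁻¹ * (vA * uA⁻¹ * vA⁻¹ * cA) = uA⁻¹ * (vA⁻¹ * cA) := by group
    rw [e1]
    simp only [mul_left_cancel_iff]
  have hBlB : ∀ p m₀, (σaB * σbB * σaB⁻¹ * σbB⁻¹) (p, m₀) =
      (uB * vB * uB⁻¹ * vB⁻¹ * p, (if p = cB then W⁻¹ else 1) * m₀) := by
    intro p m₀
    rw [twist_comm_apply hσaB hσbB, hαB, hWB]
    have e1 : vB⁻¹ * (vB * uB⁻¹ * vB⁻¹ * cB) = uB⁻¹ * (vB⁻¹ * cB) := by group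
    rw [e1]
    simp only [mul_left_cancel_iff]
  -- the generator assignment
  let σ : puncturedSurfaceGen g r → Equiv.Perm (Q × M) := fun s =>
    match s with
    | Sum.inl (i, false) => if i = i₀ then σaA else if i = iL then σaB else pl (a i)
    | Sum.inl (i, true) => if i = i₀ then σbA else if i = iL then σbB else pl (b i)
    | Sum.inr j => pl (c j)
  have hσa₀ : σ (Sum.inl (i₀, false)) = σaA := by simp [σ]
  have hσb₀ : σ (Sum.inl (i₀, true)) = σbA := by simp [σ]
  have hσaL : σ (Sum.inl (iL, false)) = σaB := by simp [σ, hi₀L.symm]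
  have hσbL : σ (Sum.inl (iL, true)) = σbB := by simp [σ, hi₀L.symm]
  have hσa : ∀ i, i ≠ i₀ → i ≠ iL → σ (Sum.inl (i, false)) = pl (a i) := fun i h1 h2 => by simp [σ, h1, h2]
  have hσb : ∀ i, i ≠ i₀ → i ≠ iL → σ (Sum.inl (i, true)) = pl (b i) := fun i h1 h2 => by simp [σ, h1, h2]
  have hσc : ∀ j, σ (Sum.inr j) = pl (c j) := fun j => rfl
  -- the blocks
  obtain ⟨Bl, hBl⟩ : ∃ Bl : Fin g → Equiv.Perm (Q × M), ∀ i, Bl i =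
      σ (Sum.inl (i, false)) * σ (Sum.inl (i, true)) * (σ (Sum.inl (i, false)))⁻¹ *
        (σ (Sum.inl (i, true)))⁻¹ := ⟨_, fun _ => rfl⟩
  have hBl_plain : ∀ i, i ≠ i₀ → i ≠ iL → Bl i = pl (w i) := by
    intro i h1 h2
    rw [hBl, hw, hσa i h1 h2, hσb i h1 h2, map_mul, map_mul, map_mul, map_inv, map_inv]
  have hBl₀ : ∀ p m₀, Bl i₀ (p, m₀) = (π (w i₀) * p, (if p = cA then W else 1) * m₀) := by
    intro p m₀
    rw [hBl, hσa₀, hσb₀, hBlA, hπw₀]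
  have hBlL : ∀ p m₀, Bl iL (p, m₀) = (π (w iL) * p, (if p = cB then W⁻¹ else 1) * m₀) := by
    intro p m₀
    rw [hBl, hσaL, hσbL, hBlB, hπwL]
  -- padded products of plain blocks are plain
  have hmid_plain : ∀ (t : ℕ), t ≤ g - 1 →
      ((List.finRange g).map fun i : Fin g =>
          if 1 ≤ (i : ℕ) then (if (i : ℕ) < t then Bl i else 1) else 1).prod =
        pl (((List.finRange g).map fun i : Fin g =>
          if 1 ≤ (i : ℕ) then (if (i : ℕ) < t then w i else 1) else 1).prod) := by
    intro t ht
    rw [map_list_prod, List.map_map]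
    refine congrArg List.prod (List.map_congr_left fun i _ => ?_)
    change _ = pl (if 1 ≤ (i : ℕ) then (if (i : ℕ) < t then w i else 1) else 1)
    by_cases h1 : 1 ≤ (i : ℕ)
    · by_cases h2 : (i : ℕ) < t
      · rw [if_pos h1, if_pos h2, if_pos h1, if_pos h2]
        refine hBl_plain i (fun h => ?_) (fun h => ?_)
        · rw [h, hi₀] at h1; simp at h1
        · rw [h, hiL] at h2; simp at h2; omega
      · rw [if_pos h1, if_neg h2, if_pos h1, if_neg h2, map_one]
    · rw [if_neg h1, if_neg h1, map_one]
  -- the product of all blocks is plain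
  have hBl_prod : ((List.finRange g).map Bl).prod = pl (((List.finRange g).map w).prod) := by
    rw [prod_map_finRange_eq_first_mul_mid_mul_last hg2 Bl, hmid_plain (g - 1) le_rfl, ← hmid, hw_split,
      map_mul, map_mul]
    refine Equiv.ext fun z => ?_
    obtain ⟨p, m₀⟩ := z
    rw [Equiv.Perm.mul_apply, Equiv.Perm.mul_apply, Equiv.Perm.mul_apply, Equiv.Perm.mul_apply,
      hBlL, hpl, hBl₀, hpl, hpl, hpl]
    refine Prod.ext rfl ?_
    change (if π mid * (π (w iL) * p) = cA then W else 1) * ((if p = cB then W⁻¹ else 1) * m₀) = m₀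
    have hiff : π mid * (π (w iL) * p) = cA ↔ p = cB := by
      rw [hcB, eq_inv_mul_iff_mul_eq, map_mul, mul_assoc]
    by_cases hp : p = cB
    · rw [if_pos (hiff.mpr hp), if_pos hp, ← mul_assoc, mul_inv_cancel, one_mul]
    · rw [if_neg (fun h => hp (hiff.mp h)), if_neg hp, one_mul, one_mul]
  -- the relator acts trivially
  have hrel : ∀ R ∈ ({relator g r} : Set (FreeGroup (puncturedSurfaceGen g r))),
      FreeGroup.lift σ R = 1 := by
    intro R hR
    rw [Set.mem_singleton_iff] at hR
    rw [hR, lift_relator]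
    have h1 : (fun i : Fin g => σ (Sum.inl (i, false)) * σ (Sum.inl (i, true)) *
        (σ (Sum.inl (i, false)))⁻¹ * (σ (Sum.inl (i, true)))⁻¹) = Bl := funext fun i => (hBl i).symm
    have h2 : ((List.finRange r).map fun j => σ (Sum.inr j)).prod =
        pl (((List.finRange r).map fun j : Fin r => c (g := g) j).prod) := by
      rw [map_list_prod, List.map_map]; rfl
    rw [h1, hBl_prod, h2, ← map_mul, hwc, map_one]
  -- the action
  let ρ : PuncturedSurfaceGroup g r →* Equiv.Perm (Q × M) := PresentedGroup.toGroup hrel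
  have hρ_of : ∀ s, ρ (PresentedGroup.of s) = σ s := fun s => PresentedGroup.toGroup.of hrel
  have hρa : ∀ i, ρ (a i) = σ (Sum.inl (i, false)) := fun i => hρ_of _
  have hρb : ∀ i, ρ (b i) = σ (Sum.inl (i, true)) := fun i => hρ_of _
  have hρw : ∀ i, ρ (w i) = Bl i := by
    intro i
    rw [hw, hBl, map_mul, map_mul, map_mul, map_inv, map_inv, hρa, hρb]
  -- every `ρ γ` is a fibred translation over `π γ`
  have hfib : ∀ γ : PuncturedSurfaceGroup g r, ∃ κ : Q → M, ∀ p m₀, ρ γ (p, m₀) = (π γ * p, κ p * m₀) := by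
    refine fibred_of_generators ρ π fun s => ?_
    rw [hρ_of]
    rcases s with ⟨i, _ | _⟩ | j
    · by_cases h1 : i = i₀
      · subst h1; exact ⟨αA, by rw [hσa₀]; exact hσaA⟩
      · by_cases h2 : i = iL
        · subst h2; exact ⟨αB, by rw [hσaL]; exact hσaB⟩
        · exact ⟨fun _ => 1, by rw [hσa i h1 h2]; exact hpl' _⟩
    · by_cases h1 : i = i₀
      · subst h1; exact ⟨fun _ => X, by rw [hσb₀]; exact hσbA⟩
      · by_cases h2 : i = iL
        · subst h2; exact ⟨fun _ => X, by rw [hσbL]; exact hσbB⟩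
        · exact ⟨fun _ => 1, by rw [hσb i h1 h2]; exact hpl' _⟩
    · exact ⟨fun _ => 1, hpl' _⟩
  -- `ρ x = Bl 0 ∘ pl x₁`: a `W`-twist supported at `p₁ = π f₁⁻¹`
  have hρx : ∀ p m₀, ρ x (p, m₀) = (π x * p, (if p = p₁ then W else 1) * m₀) := by
    intro p m₀
    have h1 : ρ x = Bl i₀ * pl x₁ := by
      rw [hxw, map_list_prod, List.map_map]
      have h2 : ((List.finRange g).map (ρ ∘ fun i : Fin g => if (i : ℕ) < g₀ then w i else 1)).prod =
          ((List.finRange g).map fun i : Fin g => if (i : ℕ) < g₀ then Bl i else 1).prod :=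
        congrArg List.prod (List.map_congr_left fun i _ => by
          change ρ (if (i : ℕ) < g₀ then w i else 1) = _
          by_cases h : (i : ℕ) < g₀
          · rw [if_pos h, if_pos h, hρw]
          · rw [if_neg h, if_neg h, map_one])
      rw [h2, prod_map_finRange_lt_eq_first_mul hgpos hg₀ Bl, hmid_plain g₀ (by omega), ← hx₁]
    rw [h1, Equiv.Perm.mul_apply, hpl, hBl₀, hx_split, map_mul, mul_assoc, hcA]
    simp only [mul_left_cancel_iff]
  -- powers of `ρ x`: plain along `⟨π x⟩`-orbits missing `p₁`, charge `W^e` at `p₁`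
  have hK1 := fun (p : Q) (hp : ∀ i : ℕ, π x ^ i * p ≠ p₁) => twist_pow_apply_of_forall_ne hρx p hp
  have hK2 := twist_pow_apply_self hρx
  -- the character of the fibre over `1`
  obtain ⟨z₁, hz₁⟩ : ∃ z₁ : Q × M, z₁ = (1, 1) := ⟨_, rfl⟩
  have hρN : ∀ {n : PuncturedSurfaceGroup g r}, n ∈ N → (ρ n z₁).1 = 1 := fun {n} hn => by
    obtain ⟨κ, hκ⟩ := hfib n
    rw [hz₁, hκ, hπN.mpr hn, one_mul]
  have hρ_snd : ∀ (γ : PuncturedSurfaceGroup g r) (p : Q) (m₀ m' : M),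
      ρ γ (p, m₀ * m') = ((ρ γ (p, m₀)).1, (ρ γ (p, m₀)).2 * m') := fun γ p m₀ m' => by
    obtain ⟨κ, hκ⟩ := hfib γ
    rw [hκ, hκ, mul_assoc]
  let ψ : N →* M :=
    { toFun := fun n => (ρ (n : PuncturedSurfaceGroup g r) z₁).2
      map_one' := by
        change (ρ ((1 : N) : PuncturedSurfaceGroup g r) z₁).2 = 1
        rw [OneMemClass.coe_one, map_one, Equiv.Perm.one_apply, hz₁]
      map_mul' := fun n n' => by
        change (ρ ((n : PuncturedSurfaceGroup g r) * n') z₁).2 =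
          (ρ (n : PuncturedSurfaceGroup g r) z₁).2 * (ρ (n' : PuncturedSurfaceGroup g r) z₁).2
        have h := hρ_snd (n : PuncturedSurfaceGroup g r) 1 1 (ρ (n' : PuncturedSurfaceGroup g r) z₁).2
        rw [one_mul, ← hz₁] at h
        have hn' : ρ (n' : PuncturedSurfaceGroup g r) z₁ = (1, (ρ (n' : PuncturedSurfaceGroup g r) z₁).2) :=
          Prod.ext (hρN n'.2) rfl
        rw [map_mul ρ, Equiv.Perm.mul_apply, hn', h] }
  have hψ : ∀ (n : PuncturedSurfaceGroup g r) (hn : n ∈ N), ψ ⟨n, hn⟩ = (ρ n z₁).2 := fun _ _ => rfl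
  -- evaluation on a level conjugate `f y f⁻¹` of an element `y` FIXING the fibre over `π f⁻¹` pointwise …
  have heval_fix : ∀ (f y : PuncturedSurfaceGroup g r) (hy : f * y * f⁻¹ ∈ N),
      (∀ m₀, ρ y (π f⁻¹, m₀) = (π f⁻¹, m₀)) → ψ ⟨f * y * f⁻¹, hy⟩ = 1 := by
    intro f y hy hfix
    rw [hψ, map_mul ρ, map_mul ρ, Equiv.Perm.mul_apply, Equiv.Perm.mul_apply]
    obtain ⟨κ, hκ⟩ := hfib f⁻¹
    have h0 : ρ f⁻¹ z₁ = (π f⁻¹, κ 1) := by rw [hz₁, hκ, mul_one, mul_one]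
    rw [h0, hfix, ← h0, ← Equiv.Perm.mul_apply, ← map_mul, mul_inv_cancel, map_one,
      Equiv.Perm.one_apply, hz₁]
  -- … or MULTIPLYING the fibre over `π f⁻¹` by `W^e`
  have heval_pow : ∀ (f y : PuncturedSurfaceGroup g r) (hy : f * y * f⁻¹ ∈ N) (e : ℕ),
      (∀ m₀, ρ y (π f⁻¹, m₀) = (π f⁻¹, W ^ e * m₀)) →
        ∃ t : M, ψ ⟨f * y * f⁻¹, hy⟩ = t⁻¹ * W ^ e * t := by
    intro f y hy e hmul
    obtain ⟨κ, hκ⟩ := hfib f⁻¹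
    obtain ⟨κ', hκ'⟩ := hfib f
    have h0 : ρ f⁻¹ z₁ = (π f⁻¹, κ 1) := by rw [hz₁, hκ, mul_one, mul_one]
    have h1 : ρ f (π f⁻¹, κ 1) = z₁ := by
      rw [← h0, ← Equiv.Perm.mul_apply, ← map_mul, mul_inv_cancel, map_one, Equiv.Perm.one_apply]
    have h2 : κ' (π f⁻¹) * κ 1 = 1 := by
      have h := h1; rw [hκ', hz₁] at h; exact (Prod.mk.inj h).2
    refine ⟨κ 1, ?_⟩
    rw [hψ, map_mul ρ, map_mul ρ, Equiv.Perm.mul_apply, Equiv.Perm.mul_apply, h0, hmul, hκ',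
      ← mul_assoc, eq_inv_of_mul_eq_one_left h2]
  refine ⟨ψ, ?_, ?_⟩
  · -- ALIVE: the level node of `f₁`
    obtain ⟨e, he1, he2, he⟩ := hK2 m
    have hxm : π x ^ m * p₁ = p₁ := by
      rw [← map_pow, hπN.mpr (Subgroup.pow_index_mem N x), one_mul]
    have hmul : ∀ m₀, ρ (x ^ m) (π f₁⁻¹, m₀) = (π f₁⁻¹, W ^ e * m₀) := fun m₀ => by
      rw [map_pow, ← hp₁, he m₀, hxm]
    obtain ⟨t, ht⟩ := heval_pow f₁ (x ^ m) (hN.conj_mem _ (Subgroup.pow_index_mem N x) f₁) e hmul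
    rw [ht]
    intro h0
    have hWe : W ^ e = 1 := by
      rw [show W ^ e = t * (t⁻¹ * W ^ e * t) * t⁻¹ by group, h0]; group
    rw [hW', inv_pow, inv_eq_one, ← pow_mul, hZq] at hWe
    have hle : q ≤ LB * LA * e :=
      Nat.le_of_dvd (Nat.mul_pos (Nat.mul_pos hLB_pos hLA_pos) (he1 hmpos)) hWe
    have hle' : LB * LA * e ≤ m ^ 3 := by
      calc LB * LA * e ≤ m * m * m := Nat.mul_le_mul (Nat.mul_le_mul hLB_le hLA_le) he2
        _ = m ^ 3 := by ring
    omega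
  · -- KILL: every other level node
    intro f₂ hf₂ z hz
    obtain ⟨hz1, hz2⟩ := Subgroup.mem_inf.mp hz
    obtain ⟨y, hy, hyz⟩ := (Subgroup.mem_smul_pointwise_iff_exists _ _ _).mp hz1
    have hz' : z = f₂ * y * f₂⁻¹ := by rw [← hyz, ConjAct.smul_def, ConjAct.ofConjAct_toConjAct]
    have hz2' : f₂ * y * f₂⁻¹ ∈ N := hz' ▸ hz2
    have hsub : (⟨z, hz.2⟩ : N) = ⟨f₂ * y * f₂⁻¹, hz2'⟩ := Subtype.ext hz'
    rw [hsub]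
    -- the `⟨π x⟩`-orbit of `π f₂⁻¹` misses `p₁`
    have hmiss : ∀ i : ℕ, π x ^ i * π f₂⁻¹ ≠ p₁ := by
      intro i hi
      apply hf₂
      rw [hp₁, ← map_pow, ← map_mul, hπ, QuotientGroup.mk'_apply, QuotientGroup.mk'_apply,
        QuotientGroup.eq] at hi
      refine Set.mem_mul.mpr ⟨x ^ i, Subgroup.npow_mem_zpowers x i,
        f₂⁻¹ * ((x ^ i * f₂⁻¹)⁻¹ * f₁⁻¹) * f₂, ?_, by group⟩
      have h := hN.conj_mem _ hi f₂⁻¹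
      rwa [inv_inv] at h
    -- natural powers of `x` conjugated into `N` by `f₂` fix the fibre over `π f₂⁻¹` pointwise
    have hynat : ∀ n : ℕ, f₂ * x ^ n * f₂⁻¹ ∈ N → ∀ m₀, ρ (x ^ n) (π f₂⁻¹, m₀) = (π f₂⁻¹, m₀) := by
      intro n hn m₀
      have hxn : x ^ n ∈ N := by
        have h := hN.conj_mem _ hn f₂⁻¹
        simpa only [inv_inv, mul_assoc, inv_mul_cancel_left, inv_mul_cancel, mul_one] using h
      have h1 : π x ^ n * π f₂⁻¹ = π f₂⁻¹ := by rw [← map_pow, hπN.mpr hxn, one_mul]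
      rw [map_pow, hK1 (π f₂⁻¹) hmiss n m₀, h1]
    obtain ⟨k, rfl⟩ := Subgroup.mem_zpowers_iff.mp hy
    rcases Int.eq_nat_or_neg k with ⟨n, rfl | rfl⟩
    · have hn : f₂ * x ^ n * f₂⁻¹ ∈ N := by
        have h := hz2'
        rwa [zpow_natCast] at h
      exact heval_fix f₂ _ hz2' fun m₀ => by rw [zpow_natCast]; exact hynat n hn m₀
    · have hn : f₂ * x ^ n * f₂⁻¹ ∈ N := by
        have h := N.inv_mem hz2'
        simpa only [mul_inv_rev, inv_inv, zpow_neg, zpow_natCast, mul_assoc] using h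
      refine heval_fix f₂ _ hz2' fun m₀ => ?_
      rw [zpow_neg, zpow_natCast, map_inv, Equiv.Perm.inv_def, Equiv.symm_apply_eq]
      exact (hynat n hn m₀).symm

end PuncturedSurfaceGroup

end Literature.GroupTheory.CombinatorialGroupTheory
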